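import Literature.MathematicalPhysics.QuantumFieldTheory.Balaban1983to89.B8Eq154Local
import Literature.MathematicalPhysics.QuantumFieldTheory.Balaban1983to89.B8ScaledSupNorm

/-!
# `Balaban1983to89.B8Eq155KLevelLocal` — [Balaban1985RegularSpaces] Sect. B p. 86: the bound (1.55) on
# `J = D^{η*}_{U₀}D^η_{U₀}A` «on Ω_j» and its norm form `|J|_(−3) ≦ 2α₀ + 36dα₂|∇^η_{U₀}A|_(−2) + 50dα₂³ + 10dα₀α₂`
# in print's MULTI-LEVEL norms `|·|_(α) = sup_j sup_{Ω_j}(Lʲη)^{−α}|·|`, for a GENERAL family `{Ω_j}_{j ≤ k}` at a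
# GENERAL unitary background `U₀`, from the LEVEL-WISE hypotheses (1.40) `U₀, U₁U₀ ∈ 𝔄_k({Ω_j}, α₀)` and (1.41)

statement-level skeleton of published theorems with citation tags; proofs where landed; nothing here is a claim about the Yang–Mills mass gap

T. Bałaban, *Spaces of regular gauge field configurations on a lattice and gauge fixing conditions*, Commun.
Math. Phys. **99** (1985) 75–102 `[Balaban1985RegularSpaces]` ("B8"; printed page = PDF page + 74).
PDF held: `paper:balaban1985-cmp99-regular-spaces-gauge-fixing` (lit store), pp. 77, 83–88 read as text
(`p0003.txt`, `p0009.txt`–`p0014.txt`).  STATUS: published, refereed.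

CITATION HEADER (lean-in-tree rule).  Cell `pub-ymgap` (YM Track A, DAG node N05 = [B8], HUMAN RULING D-0062), seat
`pub-ymgap-dag-n05-b` (FIRST-MISSING-ESTIMATE of Theorem 2 p. 83), gen 0.  WHAT IS REPRODUCED = lit-balaban SKELETON
row **B8.Eq1.55**, SECOND (norm) FORM, in print's generality: the tree had (1.55) pointwise and in norm form AT ONE
LEVEL `j` WITH EVERY HYPOTHESIS GLOBAL ON `ℤᵈ` (`B8Eq155JBound.eq155_printed` / `eq155_norm`, whose HONEST SCOPE (ii)
says «THE NORMS ARE ONE-LEVEL AND GLOBAL … the multi-level norm is … NOT print's situation»), the basic estimate (1.54)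
AT ONE BOND from local data (`B8Eq154Local.eq154_printed_loc`, p40), the multi-level norms themselves
(`B8ScaledSupNorm.msup` / `bondNorm`, r05) and, at `U₀ = 1` for `U(1)` fields only, a k-level (1.55)
(`B8Eq155AbelianMultiLevelTorus`).  This file ASSEMBLES, exactly as print does on p. 86, the k-level «on Ω_j» form of
(1.55) at a general `U1`-valued background over a non-abelian coefficient algebra from the LEVEL-WISE hypotheses
(1.40)/(1.41) — the input `h55` of the tree's bootstrap `B8.apriori_160` ((1.55) + (1.56) + (1.59) ⇒ (1.60) ⇒ (1.62),
Proposition 3 p. 87) in the multi-level currency in which (1.59) (Theorem 3.3 of [4]) is printed.  Kind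
«kernel-checked proof», theorems only: no `def`, no `… : Prop` fact, no existing module modified.  REUSED BY NAME:
`B8Eq154Local.eq154_printed_loc`, `B8Eq155JBound.{Jcur, norm_le_of_norm_sub_sub_le, norm_I_eta_sq_smul,
sq_mul_inv_cube, expCfg_iEta_mem_U1, norm_expCfg_iEta_sub_one_le}`, `B8Eq140Level.{PlaqNear, BondNear, SideTouches,
plaqTouches_of_plaqNear, sideTouches_of_bondNear}`, `B8Ineq132.{CondAt, InAk, BondTouches}`,
`B8Ineq1141SectG.{inv_mul_eta_le_one, eta_sq_mul_inv_sq, eta_sq_mul_inv_cube}`, `B8ScaledSupNorm.{msup, bondNorm,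
Bdd, bondNorm_le_of_pointwise, weight_mul_norm_le_msup, weight_neg_natCast, msup_nonneg}`, `B8.apriori_160`.

## THE PRINTED TEXT (p. 86 [PDF 12]; p. 83 [PDF 9] and p. 77 [PDF 3] for the hypotheses and conventions)

p. 83: «We assume that we have configurations U₀, U₁U₀ satisfying the following conditions
U₀, U₁U₀ ∈ 𝔄_k({Ω_j}, α₀), U₀ satisfies the additional regularity condition (3.35) in [4], (1.40)
U₁ = e^{iηA}, |A| < α₂(Lʲη)⁻¹ on Ω_j, (1.41) … (j = 0, 1, …, k above).»
p. 86: «This is the basic estimate. … We will apply it to get regularity results for A, assuming (1.40)–(1.42). From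
(1.40) the term on the left-hand side and the first term on the right-hand side can be estimated by α₀(Lʲη)⁻³η².
This implies that D^{η*}_{U₀}D^η_{U₀}A = J, |J| ≦ (2α₀ + 36dα₂(Lʲη)²|∇^η_{U₀}A| + 50dα₂³ + 10dα₀α₂)(Lʲη)⁻³, (1.55)
or |J|_(−3) ≦ 2α₀ + 36dα₂|∇^η_{U₀}A|_(−2) + 50dα₂³ + 10dα₀α₂, where the norms | |_(α) were introduced in [4]. For
the reader's convenience let us recall the definition: |A|_(α) = sup_j sup_{Ω_j} (Lʲη)^{−α}|A|.»
p. 77: «𝔄_k({Ω_j}, α₀) as a set of all gauge field configurations U on T_η satisfying the conditions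
|U(∂p) − 1| < α₀L^{−2j} for p ∈ Ω_j, j = 0, 1, …, k, (1.7) … |(D^{η*}_U ∂U)(b)| < α₀L^{−2j}(Lʲη)⁻¹ for b ∈ Ω_j,
j = 0, 1, …, k. (1.9)» and «If Ω ⊂ T_η, then we denote by Ω also the set of bonds ⋃_{x∈Ω} st(x) = {bonds b ⊂ T_η:
at least one end-point of b belongs to Ω}. Similarly for the corresponding set of plaquettes.»

## WHAT IS CERTIFIED HERE (kernel; axioms `propext` / `Classical.choice` / `Quot.sound`)

On the `ℤᵈ` carriers of the lineage (`B7Prop1Explicit`/`B8Ineq132`: sites `Fin d → ℤ`, explicit spacing `η > 0`,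
bond fields with values in the units of a complete normed `ℂ`-algebra `𝔸` with `‖1‖ = 1`, `U₀` `U1`-valued,
`U₁ = e^{iηA}`; `J = B8Eq155JBound.Jcur`):
* §1 **(1.55) AT ONE BOND from LOCAL data** (`eq155_printed_loc`, `eq155_scaled_loc`): the one-level theorems
  `B8Eq155JBound.eq155_printed` / `eq155_scaled` with every hypothesis on `A`, `∇^η_{U₀}A`, `U₁`, `U₀(∂p)` restricted to
  the plaquettes through the bond and their sides (`PlaqNear` / `BondNear`), via `B8Eq154Local.eq154_printed_loc`.
* §2 **(1.55) «on Ω_j» AT LEVEL `j` ON A SET `S` FROM THE LEVEL-`j` DATA ON `S`** (`eq155_scaled_condAt`): (1.7)/(1.9)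
  at level `j` on `S` for `U₀` and for `U₁U₀` (`B8Ineq132.CondAt`, = the level-`j` clause of (1.40)), (1.41) at level
  `j` on the sides of the plaquettes touching `S` (`SideTouches S`, LOCATED READING (i)), a gradient datum `G` there
  ⇒ `(Lʲη)³|J(b)| ≦ 2α₀ + 36dα₂(Lʲη)²G + 50dα₂³ + 10dα₀α₂` at every bond `b` touching `S`.
* §3 **(1.55), NORM FORM, AT `k` LEVELS FOR A GENERAL FAMILY `{Ω_j}_{j ≤ k}`** (`eq155_norm_kLevel`): from (1.40)
  `U₀, U₁U₀ ∈ 𝔄_k({Ω_j}, α₀)` (`B8Ineq132.InAk`), (1.41) on `SideTouches (Ω j)` for every `j ≤ k`, and any bound `g`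
  of the `(Lʲη)²`-weighted covariant gradient there: `|J|_(−3) ≦ 2α₀ + 36dα₂·g + 50dα₂³ + 10dα₀α₂`, where
  `|J|_(−3) = B8ScaledSupNorm.bondNorm L k η (−3) Ω J` is print's `sup_{j ≤ k} sup_{b ∈ Ω_j}(Lʲη)³|J(b)|`;
  `eq155_norm_kLevel_msup`: the same with `g := sup_{j ≤ k} sup_{SideTouches Ω_j}(Lʲη)²|∇^η_{U₀}A|` (the tree's
  `B8ScaledSupNorm.msup` over that membership predicate; bounded family).
* §4 THE HERMITIAN CASE (`𝔸` a C⋆-algebra, `A` self-adjoint: `U₁ = e^{iηA}` unitary and `|U₁ − 1| ≤ η|A|`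
  discharged): `eq155_norm_kLevel_hermitian`, and the SENTENCE SHAPE `eq155_kLevel` — `∃ c > 0` (`c = 1/(16d)`) such
  that for `0 ≤ α₀` and `0 ≤ α₂ ≤ c` the k-level norm inequality holds for every family `{Ω_j}`, every `U1`-valued
  `U₀` and every Hermitian `A` subject to (1.40)/(1.41).
* §5 THE FEED INTO (1.59) ⇒ (1.60) AT `k` LEVELS (`apriori_160_kLevel`): with `nJ := |J|_(−3)` the k-level norm of §3,
  (1.56) and the four Theorem-3.3-of-[4] bounds (1.59) as real hypotheses in the same currency, «B₀36dα₂ ≦ 1/2» and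
  `50dα₂ ≤ 1`: the four bounds (1.60) — `B8.apriori_160` applied with `h55 := eq155_norm_kLevel_hermitian`.

## HONEST SCOPE / LOCATED READING — what is NOT claimed

(i) «ON Ω_j» FOR `|A|` (1.41) AND FOR THE GRADIENT DATUM IS READ ONE LAYER WIDER THAN p. 77's BOND CONVENTION, exactly
as in p40's `B8Eq140Level.Cond140` / `B8Prop7ClassAkLocal` (cell GAPS G-B8-16): the basic estimate at a bond `b`
touching `Ω_j` reads `A`, `U₁`, `∇^η_{U₀}A` on all sides of the plaquettes through `b` (`BondNear b ⊆ SideTouches Ω_j`),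
two of which need not touch `Ω_j`; print's constants `36d`, `50d`, `10d` presuppose the level-`j` bound there.  Under the
literal convention those sides are controlled at level `j − 1` on `Ω_{j−1}` (by (1.4)) with threshold `Lα₂(Lʲη)⁻¹`,
changing the constants by `L`-dependent factors — recorded, not reproduced.  (ii) (1.40)'s clause «U₀ satisfies
(3.35) in [4]» and (1.42) are not used by (1.55) and not typed here; (1.9) for `U₀` and `U₁U₀` enters through `CondAt`
/ `InAk` (strict `<`, as printed), (1.7) for `U₀` likewise; nothing is derived from (3.35).  (iii) The side conditions
are those of the parents: `16α₂ ≤ 1` and `5α₂(d − 1) ≤ 4` (from `16α₂(Lʲη)⁻¹η ≤ 1 ∧ 5α₂(Lʲη)⁻¹η(d − 1) ≤ 4` of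
`eq154_printed_loc`, using `(Lʲη)⁻¹η ≤ 1` for `L ≥ 1`); the sentence shape uses `c = 1/(16d)`.  (iv) The gradient on
the right-hand side is a DATUM `g` (any common bound of `(Lʲη)²|(D^η_{U₀,κ}A_τ)(y)|` over `j ≤ k` and the
`SideTouches (Ω j)` bonds `⟨y, y + e_τ⟩`, all `κ`, diagonal entries included as in (1.52)); `eq155_norm_kLevel_msup`
instantiates it by the corresponding weighted supremum under an explicit boundedness hypothesis (a real `iSup` is `0`
on an unbounded family, cf. `B8ScaledSupNorm`).  It is NOT claimed that this supremum equals
`B8ScaledSupNorm.covGradNorm` (which runs over the bonds touching `Ω_j` only).  (v) `T_η` ↦ `ℤᵈ`, `η > 0` explicit,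
`L ≥ 1`; print's strict `<` in (1.41) is taken as `≤`, the conclusions are `≤`.  (vi) NOT HERE: (1.56)–(1.62) beyond the
real-arithmetic feed of §5 ((1.56) = `B8Eq156Prop4`, (1.57)–(1.58) = `B8Eq157Translation`, (1.59) = Theorem 3.3 of
[4], a hypothesis of DAG node N05), Proposition 3 itself (`B8Prop3Concrete` at one level), anything at `U₀ = 1`
(r05's `B8Prop3MultiLevelTorus*`).  Nothing here is progress on the summit; the value is the k-level «on Ω_j»
certificate of (1.55) at a general background, the first display of the printed proof of Theorem 2 (pp. 83–88)
that the tree had only globally / at one level.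
-/

noncomputable section

open scoped BigOperators
open NormedSpace Finset

namespace Literature.MathematicalPhysics.QuantumFieldTheory.Balaban1983to89.B8Eq155KLevelLocal

open B7Prop1Explicit
open B8Lemma1NonAbelian (mulCfg)
open B8Ineq132 (plaqF covDeriv covDerivFwd covDiv CondAt InAk PlaqTouches BondTouches)
open B8Eq143PlaqExpansion (pdiv)
open B8Eq146AExpansion (expCfg iEta plaqCovDeriv)
open B8Eq155JBound (Jcur Jcur_def norm_le_of_norm_sub_sub_le norm_I_eta_sq_smul sq_mul_inv_cube)
open B8Ineq1141SectG (inv_mul_eta_le_one eta_sq_mul_inv_sq eta_sq_mul_inv_cube)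
open B8Eq140Level
open B8Eq154Local
open B8ScaledSupNorm (msup weight bondNorm Bdd)

-- `Site` alone would resolve to the torus sites of `Setup.lean`; re-export the `ℤ^d` sites of `B7Prop1Explicit`.
export B7Prop1Explicit (Site)

variable {d : ℕ}

/-! ## §1 (1.55) at one bond from local data -/

section Pointwise

variable {𝔸 : Type*} [NormedRing 𝔸] [NormOneClass 𝔸] [NormedAlgebra ℂ 𝔸] [CompleteSpace 𝔸]

/-- **(1.55) AS PRINTED, FIRST FORM, AT ONE BOND `b = ⟨x, x + ηe_μ⟩` FROM LOCAL DATA**: for `U1`-valued `U₀`,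
`U₁ = e^{iηA}` `U1`-valued, and, on the `BondNear` bonds of `b`, `|A| ≤ α₂(Lʲη)⁻¹`, `|U₁ − 1| ≤ α₂(Lʲη)⁻¹η`, at the
gradient entries based there `|∇^η_{U₀}A| ≤ G` (`G ≥ 0`), on the plaquettes through `b` `|U₀(∂p) − 1| ≤ α₀η²(Lʲη)⁻²`,
and AT `b` the two (1.9)-bounds «estimated by α₀(Lʲη)⁻³η²» for `U₁U₀` and `U₀`:
`|J(b)| ≤ (2α₀ + 36dα₂(Lʲη)²G + 50dα₂³ + 10dα₀α₂)(Lʲη)⁻³`. [cite: Balaban1985RegularSpaces, (1.55) p.86] -/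
theorem eq155_printed_loc {η : ℝ} (hη : 0 < η) {U₀ : Site d → Fin d → 𝔸ˣ} (h₀ : ∀ y κ, U₀ y κ ∈ U1 𝔸)
    {A : Site d → Fin d → 𝔸} (h₁ : ∀ y κ, expCfg (iEta η A) y κ ∈ U1 𝔸) {L j : ℕ} {α₀ α₂ G : ℝ}
    (hα₀ : 0 ≤ α₀) (hα₂ : 0 ≤ α₂) (hG0 : 0 ≤ G) {μ : Fin d} {x : Site d}
    (hA : ∀ y τ, BondNear μ x y τ → ‖A y τ‖ ≤ α₂ * ((L : ℝ) ^ j * η)⁻¹)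
    (hG : ∀ (y : Site d) (κ τ : Fin d), BondNear μ x y τ → ‖covDerivFwd η U₀ κ (fun z => A z τ) y‖ ≤ G)
    (hu : ∀ y τ, BondNear μ x y τ → ‖(expCfg (iEta η A) y τ : 𝔸) - 1‖ ≤ α₂ * ((L : ℝ) ^ j * η)⁻¹ * η)
    (hp : ∀ y κ ν, PlaqNear μ x y κ ν → ‖plaqF U₀ κ ν y - 1‖ ≤ α₀ * η ^ 2 * (((L : ℝ) ^ j * η)⁻¹) ^ 2)
    (hsmall : 16 * (α₂ * ((L : ℝ) ^ j * η)⁻¹ * η) ≤ 1)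
    (hd : 5 * (α₂ * ((L : ℝ) ^ j * η)⁻¹ * η) * ((d : ℝ) - 1) ≤ 4)
    (h40₁ : ‖covDiv η (mulCfg (expCfg (iEta η A)) U₀) μ x‖ ≤ α₀ * η ^ 2 * (((L : ℝ) ^ j * η)⁻¹) ^ 3)
    (h40₀ : ‖covDiv η U₀ μ x‖ ≤ α₀ * η ^ 2 * (((L : ℝ) ^ j * η)⁻¹) ^ 3) :
    ‖Jcur η U₀ A μ x‖ ≤ (2 * α₀ + 36 * d * α₂ * (((L : ℝ) ^ j * η) ^ 2 * G) + 50 * d * α₂ ^ 3 +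
        10 * d * α₀ * α₂) * (((L : ℝ) ^ j * η)⁻¹) ^ 3 := by
  set s : ℝ := (L : ℝ) ^ j * η with hs
  set r : ℝ := s⁻¹ with hr
  have key := norm_le_of_norm_sub_sub_le h40₁ h40₀
    (eq154_printed_loc hη h₀ h₁ hα₀ hα₂ hG0 hA hG hu hp hsmall hd)
  rw [norm_I_eta_sq_smul] at key
  have hη2 : 0 < η ^ 2 := by positivity
  -- cancel the common factor `η²`
  have hJ : ‖Jcur η U₀ A μ x‖ ≤ 2 * α₀ * r ^ 3 + 36 * d * (α₂ * r) * G + 50 * d * α₂ ^ 3 * r ^ 3 +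
      10 * d * α₀ * α₂ * r ^ 3 := by
    rw [Jcur_def, ← mul_le_mul_iff_right₀ hη2]
    refine key.trans_eq ?_
    ring
  refine hJ.trans_eq ?_
  have hu := sq_mul_inv_cube s
  calc 2 * α₀ * r ^ 3 + 36 * d * (α₂ * r) * G + 50 * d * α₂ ^ 3 * r ^ 3 + 10 * d * α₀ * α₂ * r ^ 3
      = 2 * α₀ * r ^ 3 + 36 * d * α₂ * (s ^ 2 * r ^ 3) * G + 50 * d * α₂ ^ 3 * r ^ 3 +
          10 * d * α₀ * α₂ * r ^ 3 := by rw [hr, hu]; ring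
    _ = _ := by ring

/-- **(1.55) AT ONE BOND WITH THE WEIGHT ON THE LEFT** (`L ≥ 1`), from the same local data:
`(Lʲη)³|J(b)| ≤ 2α₀ + 36dα₂(Lʲη)²G + 50dα₂³ + 10dα₀α₂`. [cite: Balaban1985RegularSpaces, (1.55) p.86] -/
theorem eq155_scaled_loc {η : ℝ} (hη : 0 < η) {U₀ : Site d → Fin d → 𝔸ˣ} (h₀ : ∀ y κ, U₀ y κ ∈ U1 𝔸)
    {A : Site d → Fin d → 𝔸} (h₁ : ∀ y κ, expCfg (iEta η A) y κ ∈ U1 𝔸) {L j : ℕ} (hL : 0 < L) {α₀ α₂ G : ℝ}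
    (hα₀ : 0 ≤ α₀) (hα₂ : 0 ≤ α₂) (hG0 : 0 ≤ G) {μ : Fin d} {x : Site d}
    (hA : ∀ y τ, BondNear μ x y τ → ‖A y τ‖ ≤ α₂ * ((L : ℝ) ^ j * η)⁻¹)
    (hG : ∀ (y : Site d) (κ τ : Fin d), BondNear μ x y τ → ‖covDerivFwd η U₀ κ (fun z => A z τ) y‖ ≤ G)
    (hu : ∀ y τ, BondNear μ x y τ → ‖(expCfg (iEta η A) y τ : 𝔸) - 1‖ ≤ α₂ * ((L : ℝ) ^ j * η)⁻¹ * η)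
    (hp : ∀ y κ ν, PlaqNear μ x y κ ν → ‖plaqF U₀ κ ν y - 1‖ ≤ α₀ * η ^ 2 * (((L : ℝ) ^ j * η)⁻¹) ^ 2)
    (hsmall : 16 * (α₂ * ((L : ℝ) ^ j * η)⁻¹ * η) ≤ 1)
    (hd : 5 * (α₂ * ((L : ℝ) ^ j * η)⁻¹ * η) * ((d : ℝ) - 1) ≤ 4)
    (h40₁ : ‖covDiv η (mulCfg (expCfg (iEta η A)) U₀) μ x‖ ≤ α₀ * η ^ 2 * (((L : ℝ) ^ j * η)⁻¹) ^ 3)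
    (h40₀ : ‖covDiv η U₀ μ x‖ ≤ α₀ * η ^ 2 * (((L : ℝ) ^ j * η)⁻¹) ^ 3) :
    ((L : ℝ) ^ j * η) ^ 3 * ‖Jcur η U₀ A μ x‖ ≤
      2 * α₀ + 36 * d * α₂ * (((L : ℝ) ^ j * η) ^ 2 * G) + 50 * d * α₂ ^ 3 + 10 * d * α₀ * α₂ := by
  set s : ℝ := (L : ℝ) ^ j * η with hs
  have hs0 : 0 < s := by positivity
  have h := eq155_printed_loc hη h₀ h₁ hα₀ hα₂ hG0 hA hG hu hp hsmall hd h40₁ h40₀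
  have h3 : 0 < s ^ 3 := by positivity
  have e : s ^ 3 * (s⁻¹) ^ 3 = 1 := by rw [← mul_pow, mul_inv_cancel₀ hs0.ne', one_pow]
  calc s ^ 3 * ‖Jcur η U₀ A μ x‖
      ≤ s ^ 3 * ((2 * α₀ + 36 * d * α₂ * (s ^ 2 * G) + 50 * d * α₂ ^ 3 + 10 * d * α₀ * α₂) * (s⁻¹) ^ 3) :=
        mul_le_mul_of_nonneg_left h h3.le
    _ = (2 * α₀ + 36 * d * α₂ * (s ^ 2 * G) + 50 * d * α₂ ^ 3 + 10 * d * α₀ * α₂) * (s ^ 3 * (s⁻¹) ^ 3) := by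
        ring
    _ = _ := by rw [e, mul_one]

end Pointwise

/-! ## §2 (1.55) «on Ω_j» at one level on one set from the level-`j` data -/

section Level

variable {𝔸 : Type*} [NormedRing 𝔸] [NormOneClass 𝔸] [NormedAlgebra ℂ 𝔸] [CompleteSpace 𝔸]

/-- The parents' side conditions `16α₂(Lʲη)⁻¹η ≤ 1 ∧ 5α₂(Lʲη)⁻¹η(d − 1) ≤ 4` from `16α₂ ≤ 1`, `5α₂(d − 1) ≤ 4`
(`L ≥ 1`, `η > 0`, `d ≥ 1`, since `(Lʲη)⁻¹η = L^{−j} ≤ 1`). [cite: Balaban1985RegularSpaces, (1.8) p.77, (1.54) p.85] -/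
theorem side_conditions {L : ℕ} (hL : 1 ≤ L) {η : ℝ} (hη : 0 < η) (j : ℕ) (hd1 : 1 ≤ d) {α₂ : ℝ}
    (hα₂ : 0 ≤ α₂) (h16 : 16 * α₂ ≤ 1) (hd5 : 5 * α₂ * ((d : ℝ) - 1) ≤ 4) :
    16 * (α₂ * ((L : ℝ) ^ j * η)⁻¹ * η) ≤ 1 ∧ 5 * (α₂ * ((L : ℝ) ^ j * η)⁻¹ * η) * ((d : ℝ) - 1) ≤ 4 := by
  have ht1 : ((L : ℝ) ^ j * η)⁻¹ * η ≤ 1 := inv_mul_eta_le_one hL hη j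
  have ht0 : 0 ≤ ((L : ℝ) ^ j * η)⁻¹ * η := by positivity
  have ha : α₂ * ((L : ℝ) ^ j * η)⁻¹ * η ≤ α₂ := by
    have := mul_le_mul_of_nonneg_left ht1 hα₂
    simpa [mul_assoc] using this
  have ha0 : 0 ≤ α₂ * ((L : ℝ) ^ j * η)⁻¹ * η := by positivity
  have hd0 : (0 : ℝ) ≤ (d : ℝ) - 1 := by
    have : (1 : ℝ) ≤ d := by exact_mod_cast hd1
    linarith
  refine ⟨by linarith, ?_⟩
  calc 5 * (α₂ * ((L : ℝ) ^ j * η)⁻¹ * η) * ((d : ℝ) - 1) ≤ 5 * α₂ * ((d : ℝ) - 1) := by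
        have := mul_le_mul_of_nonneg_right ha hd0
        nlinarith
    _ ≤ 4 := hd5

/-- **(1.55) «on Ω_j» AT LEVEL `j` ON A SET `S`, from the LEVEL-`j` data on `S`**: for `U1`-valued `U₀`,
`U₁ = e^{iηA}` `U1`-valued, `η > 0`, `L ≥ 1`, `α₀, α₂, G ≥ 0`, `16α₂ ≤ 1`, `5α₂(d − 1) ≤ 4`: if (1.7)/(1.9) hold at
level `j` on `S` for `U₀` AND for `U₁U₀` (`CondAt`, the level-`j` clause of (1.40) «U₀, U₁U₀ ∈ 𝔄_k({Ω_j}, α₀)»),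
(1.41) `|A| ≤ α₂(Lʲη)⁻¹` and the bookkeeping `|U₁ − 1| ≤ α₂(Lʲη)⁻¹η` hold on the sides of the plaquettes touching `S`
(`SideTouches S`, LOCATED READING (i)), and `|(D^η_{U₀,κ}A_τ)(y)| ≤ G` for those sides `⟨y, y + e_τ⟩`, then at every
bond `b` touching `S`: `(Lʲη)³|J(b)| ≤ 2α₀ + 36dα₂(Lʲη)²G + 50dα₂³ + 10dα₀α₂`.
[cite: Balaban1985RegularSpaces, (1.55) p.86 (with (1.40)-(1.41) p.83, (1.7)/(1.9) p.77)] -/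
theorem eq155_scaled_condAt {η : ℝ} (hη : 0 < η) {L : ℕ} (hL : 1 ≤ L) {j : ℕ} {U₀ : Site d → Fin d → 𝔸ˣ}
    (h₀ : ∀ y κ, U₀ y κ ∈ U1 𝔸) {A : Site d → Fin d → 𝔸} (h₁ : ∀ y κ, expCfg (iEta η A) y κ ∈ U1 𝔸)
    {α₀ α₂ G : ℝ} (hα₀ : 0 ≤ α₀) (hα₂ : 0 ≤ α₂) (h16 : 16 * α₂ ≤ 1) (hd5 : 5 * α₂ * ((d : ℝ) - 1) ≤ 4)
    (hG0 : 0 ≤ G) {S : Set (Site d)} (h40₀ : CondAt L η α₀ j S U₀)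
    (h40₁ : CondAt L η α₀ j S (mulCfg (expCfg (iEta η A)) U₀))
    (h41 : ∀ y τ, SideTouches S y τ → ‖A y τ‖ ≤ α₂ * ((L : ℝ) ^ j * η)⁻¹)
    (hu : ∀ y τ, SideTouches S y τ → ‖(expCfg (iEta η A) y τ : 𝔸) - 1‖ ≤ α₂ * ((L : ℝ) ^ j * η)⁻¹ * η)
    (hG : ∀ (y : Site d) (κ τ : Fin d), SideTouches S y τ → ‖covDerivFwd η U₀ κ (fun z => A z τ) y‖ ≤ G)
    {x : Site d} {μ : Fin d} (hb : BondTouches S x μ) :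
    ((L : ℝ) ^ j * η) ^ 3 * ‖Jcur η U₀ A μ x‖ ≤
      2 * α₀ + 36 * d * α₂ * (((L : ℝ) ^ j * η) ^ 2 * G) + 50 * d * α₂ ^ 3 + 10 * d * α₀ * α₂ := by
  have hd1 : 1 ≤ d := Fin.pos μ
  obtain ⟨hsmall, hd'⟩ := side_conditions hL hη j hd1 hα₂ h16 hd5
  -- the plaquettes through `b` touch `S`, so (1.7) for `U₀` at level `j` applies to them, in the units of (1.8)
  have hp : ∀ y κ ν, PlaqNear μ x y κ ν → ‖plaqF U₀ κ ν y - 1‖ ≤ α₀ * η ^ 2 * (((L : ℝ) ^ j * η)⁻¹) ^ 2 := by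
    intro y κ ν hq
    have h := (h40₀.1 y κ ν hq.1 (plaqTouches_of_plaqNear hb hq)).le
    rwa [← eta_sq_mul_inv_sq (L := L) hη.ne' j, ← mul_assoc] at h
  -- (1.9) at `b` for `U₀` and for `U₁U₀`, in the units `α₀L^{−2j}(Lʲη)⁻¹ = α₀η²(Lʲη)⁻³`
  have hunits : α₀ * η ^ 2 * (((L : ℝ) ^ j * η)⁻¹) ^ 3 =
      α₀ * (((L : ℝ) ^ j)⁻¹) ^ 2 * ((L : ℝ) ^ j * η)⁻¹ := by
    rw [mul_assoc, eta_sq_mul_inv_cube (L := L) hη.ne' j, ← mul_assoc]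
  have h9₀ : ‖covDiv η U₀ μ x‖ ≤ α₀ * η ^ 2 * (((L : ℝ) ^ j * η)⁻¹) ^ 3 := by
    rw [hunits]; exact (h40₀.2 x μ hb).le
  have h9₁ : ‖covDiv η (mulCfg (expCfg (iEta η A)) U₀) μ x‖ ≤ α₀ * η ^ 2 * (((L : ℝ) ^ j * η)⁻¹) ^ 3 := by
    rw [hunits]; exact (h40₁.2 x μ hb).le
  exact eq155_scaled_loc hη h₀ h₁ hL hα₀ hα₂ hG0
    (fun y τ hn => h41 y τ (sideTouches_of_bondNear hb hn))
    (fun y κ τ hn => hG y κ τ (sideTouches_of_bondNear hb hn))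
    (fun y τ hn => hu y τ (sideTouches_of_bondNear hb hn)) hp hsmall hd' h9₁ h9₀

/-- **(1.55) «on Ω_j», POINTWISE PRINTED FORM AT LEVEL `j` ON `S`** (same data):
`|J(b)| ≤ (2α₀ + 36dα₂(Lʲη)²G + 50dα₂³ + 10dα₀α₂)(Lʲη)⁻³` at every bond `b` touching `S`.
[cite: Balaban1985RegularSpaces, (1.55) p.86] -/
theorem eq155_printed_condAt {η : ℝ} (hη : 0 < η) {L : ℕ} (hL : 1 ≤ L) {j : ℕ} {U₀ : Site d → Fin d → 𝔸ˣ}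
    (h₀ : ∀ y κ, U₀ y κ ∈ U1 𝔸) {A : Site d → Fin d → 𝔸} (h₁ : ∀ y κ, expCfg (iEta η A) y κ ∈ U1 𝔸)
    {α₀ α₂ G : ℝ} (hα₀ : 0 ≤ α₀) (hα₂ : 0 ≤ α₂) (h16 : 16 * α₂ ≤ 1) (hd5 : 5 * α₂ * ((d : ℝ) - 1) ≤ 4)
    (hG0 : 0 ≤ G) {S : Set (Site d)} (h40₀ : CondAt L η α₀ j S U₀)
    (h40₁ : CondAt L η α₀ j S (mulCfg (expCfg (iEta η A)) U₀))
    (h41 : ∀ y τ, SideTouches S y τ → ‖A y τ‖ ≤ α₂ * ((L : ℝ) ^ j * η)⁻¹)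
    (hu : ∀ y τ, SideTouches S y τ → ‖(expCfg (iEta η A) y τ : 𝔸) - 1‖ ≤ α₂ * ((L : ℝ) ^ j * η)⁻¹ * η)
    (hG : ∀ (y : Site d) (κ τ : Fin d), SideTouches S y τ → ‖covDerivFwd η U₀ κ (fun z => A z τ) y‖ ≤ G)
    {x : Site d} {μ : Fin d} (hb : BondTouches S x μ) :
    ‖Jcur η U₀ A μ x‖ ≤ (2 * α₀ + 36 * d * α₂ * (((L : ℝ) ^ j * η) ^ 2 * G) + 50 * d * α₂ ^ 3 +
        10 * d * α₀ * α₂) * (((L : ℝ) ^ j * η) ^ 3)⁻¹ := by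
  set s : ℝ := (L : ℝ) ^ j * η with hs
  have hs0 : 0 < s := by positivity
  have h3 : 0 < s ^ 3 := by positivity
  have h := eq155_scaled_condAt hη hL h₀ h₁ hα₀ hα₂ h16 hd5 hG0 h40₀ h40₁ h41 hu hG hb
  rw [le_mul_inv_iff₀ h3]
  calc ‖Jcur η U₀ A μ x‖ * s ^ 3 = s ^ 3 * ‖Jcur η U₀ A μ x‖ := mul_comm _ _
    _ ≤ _ := h

end Level

/-! ## §3 (1.55), norm form, at `k` levels for a general family `{Ω_j}_{j ≤ k}` -/

section KLevel

variable {𝔸 : Type*} [NormedRing 𝔸] [NormOneClass 𝔸] [NormedAlgebra ℂ 𝔸] [CompleteSpace 𝔸]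

/-- **(1.55), SECOND (NORM) FORM, AT `k` LEVELS**: «|J|_(−3) ≦ 2α₀ + 36dα₂|∇^η_{U₀}A|_(−2) + 50dα₂³ + 10dα₀α₂» with
`|J|_(−3) = sup_{j ≤ k} sup_{b ∈ Ω_j}(Lʲη)³|J(b)|` (`B8ScaledSupNorm.bondNorm … (−3)`), for a GENERAL family
`{Ω_j}_{j ≤ k}`, from (1.40) `U₀, U₁U₀ ∈ 𝔄_k({Ω_j}, α₀)` (`InAk`), (1.41) and the `U₁`-bookkeeping on `SideTouches (Ω j)`
for every `j ≤ k`, and any common bound `g ≥ 0` of `(Lʲη)²|(D^η_{U₀,κ}A_τ)(y)|` over `j ≤ k` and the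
`SideTouches (Ω j)` bonds `⟨y, y + e_τ⟩` (the datum standing for `|∇^η_{U₀}A|_(−2)`); `16α₂ ≤ 1`, `5α₂(d − 1) ≤ 4`.
[cite: Balaban1985RegularSpaces, (1.55) p.86 (second form, with the definition of |·|_(α))] -/
theorem eq155_norm_kLevel {η : ℝ} (hη : 0 < η) {L : ℕ} (hL : 1 ≤ L) {k : ℕ} {U₀ : Site d → Fin d → 𝔸ˣ}
    (h₀ : ∀ y κ, U₀ y κ ∈ U1 𝔸) {A : Site d → Fin d → 𝔸} (h₁ : ∀ y κ, expCfg (iEta η A) y κ ∈ U1 𝔸)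
    {α₀ α₂ g : ℝ} (hα₀ : 0 ≤ α₀) (hα₂ : 0 ≤ α₂) (h16 : 16 * α₂ ≤ 1) (hd5 : 5 * α₂ * ((d : ℝ) - 1) ≤ 4)
    (hg0 : 0 ≤ g) {Ω : ℕ → Set (Site d)} (h40₀ : InAk L k η α₀ Ω U₀)
    (h40₁ : InAk L k η α₀ Ω (mulCfg (expCfg (iEta η A)) U₀))
    (h41 : ∀ j, j ≤ k → ∀ y τ, SideTouches (Ω j) y τ → ‖A y τ‖ ≤ α₂ * ((L : ℝ) ^ j * η)⁻¹)
    (hu : ∀ j, j ≤ k → ∀ y τ, SideTouches (Ω j) y τ →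
      ‖(expCfg (iEta η A) y τ : 𝔸) - 1‖ ≤ α₂ * ((L : ℝ) ^ j * η)⁻¹ * η)
    (hg : ∀ j, j ≤ k → ∀ (y : Site d) (κ τ : Fin d), SideTouches (Ω j) y τ →
      ((L : ℝ) ^ j * η) ^ 2 * ‖covDerivFwd η U₀ κ (fun z => A z τ) y‖ ≤ g) :
    bondNorm L k η (-(3 : ℝ)) Ω (fun x μ => Jcur η U₀ A μ x) ≤
      2 * α₀ + 36 * d * α₂ * g + 50 * d * α₂ ^ 3 + 10 * d * α₀ * α₂ := by
  have hc : 0 ≤ 2 * α₀ + 36 * d * α₂ * g + 50 * d * α₂ ^ 3 + 10 * d * α₀ * α₂ := by positivity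
  refine B8ScaledSupNorm.bondNorm_le_of_pointwise hL hη 3 hc fun j hj x μ hb => ?_
  set s : ℝ := (L : ℝ) ^ j * η with hs
  have hs0 : 0 < s := by positivity
  have h3 : 0 < s ^ 3 := by positivity
  -- the pointwise gradient datum at level `j`: `G = (Lʲη)⁻²·g`
  have hG : ∀ (y : Site d) (κ τ : Fin d), SideTouches (Ω j) y τ →
      ‖covDerivFwd η U₀ κ (fun z => A z τ) y‖ ≤ (s⁻¹) ^ 2 * g := by
    intro y κ τ hy
    have h2 : 0 < s ^ 2 := by positivity
    rw [← mul_le_mul_iff_right₀ h2]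
    calc s ^ 2 * ‖covDerivFwd η U₀ κ (fun z => A z τ) y‖ ≤ g := hg j hj y κ τ hy
      _ = s ^ 2 * ((s⁻¹) ^ 2 * g) := by
          rw [← mul_assoc, ← mul_pow, mul_inv_cancel₀ hs0.ne', one_pow, one_mul]
  have e : s ^ 2 * ((s⁻¹) ^ 2 * g) = g := by
    rw [← mul_assoc, ← mul_pow, mul_inv_cancel₀ hs0.ne', one_pow, one_mul]
  have h := eq155_scaled_condAt hη hL h₀ h₁ hα₀ hα₂ h16 hd5 (by positivity : 0 ≤ (s⁻¹) ^ 2 * g)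
    (h40₀ j hj) (h40₁ j hj) (h41 j hj) (hu j hj) hG hb
  rw [e] at h
  show ‖Jcur η U₀ A μ x‖ ≤ _ * (s ^ 3)⁻¹
  rw [le_mul_inv_iff₀ h3]
  calc ‖Jcur η U₀ A μ x‖ * s ^ 3 = s ^ 3 * ‖Jcur η U₀ A μ x‖ := mul_comm _ _
    _ ≤ _ := h

/-- **(1.55), NORM FORM AT `k` LEVELS, WITH THE GRADIENT NORM AS A SUPREMUM**: the same with
`g := sup_{j ≤ k} sup_{SideTouches Ω_j}(Lʲη)²|(D^η_{U₀,κ}A_τ)(y)|` — the tree's multi-level weighted supremum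
`B8ScaledSupNorm.msup` at exponent `−2` over the membership predicate «`⟨y, y + e_τ⟩` is a side of a plaquette touching
`Ω_j`» (LOCATED READING (i)), for a family bounded in the sense of `B8ScaledSupNorm.Bdd`.
[cite: Balaban1985RegularSpaces, (1.55) p.86 (second form)] -/
theorem eq155_norm_kLevel_msup {η : ℝ} (hη : 0 < η) {L : ℕ} (hL : 1 ≤ L) {k : ℕ} {U₀ : Site d → Fin d → 𝔸ˣ}
    (h₀ : ∀ y κ, U₀ y κ ∈ U1 𝔸) {A : Site d → Fin d → 𝔸} (h₁ : ∀ y κ, expCfg (iEta η A) y κ ∈ U1 𝔸)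
    {α₀ α₂ : ℝ} (hα₀ : 0 ≤ α₀) (hα₂ : 0 ≤ α₂) (h16 : 16 * α₂ ≤ 1) (hd5 : 5 * α₂ * ((d : ℝ) - 1) ≤ 4)
    {Ω : ℕ → Set (Site d)} (h40₀ : InAk L k η α₀ Ω U₀)
    (h40₁ : InAk L k η α₀ Ω (mulCfg (expCfg (iEta η A)) U₀))
    (h41 : ∀ j, j ≤ k → ∀ y τ, SideTouches (Ω j) y τ → ‖A y τ‖ ≤ α₂ * ((L : ℝ) ^ j * η)⁻¹)
    (hu : ∀ j, j ≤ k → ∀ y τ, SideTouches (Ω j) y τ →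
      ‖(expCfg (iEta η A) y τ : 𝔸) - 1‖ ≤ α₂ * ((L : ℝ) ^ j * η)⁻¹ * η)
    (hB : Bdd L k η (-(2 : ℝ)) (fun j (t : Fin d × Fin d × Site d) => SideTouches (Ω j) t.2.2 t.2.1)
      (fun t => covDerivFwd η U₀ t.1 (fun z => A z t.2.1) t.2.2)) :
    bondNorm L k η (-(3 : ℝ)) Ω (fun x μ => Jcur η U₀ A μ x) ≤
      2 * α₀ + 36 * d * α₂ *
          msup L k η (-(2 : ℝ)) (fun j (t : Fin d × Fin d × Site d) => SideTouches (Ω j) t.2.2 t.2.1)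
            (fun t => covDerivFwd η U₀ t.1 (fun z => A z t.2.1) t.2.2) +
        50 * d * α₂ ^ 3 + 10 * d * α₀ * α₂ := by
  set g : ℝ := msup L k η (-(2 : ℝ)) (fun j (t : Fin d × Fin d × Site d) => SideTouches (Ω j) t.2.2 t.2.1)
    (fun t => covDerivFwd η U₀ t.1 (fun z => A z t.2.1) t.2.2) with hg_def
  have hg0 : 0 ≤ g := B8ScaledSupNorm.msup_nonneg L k hη.le _ _ _
  refine eq155_norm_kLevel hη hL h₀ h₁ hα₀ hα₂ h16 hd5 hg0 h40₀ h40₁ h41 hu fun j hj y κ τ hy => ?_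
  have h := B8ScaledSupNorm.weight_mul_norm_le_msup hB hj (i := (κ, τ, y)) hy
  have e : weight L η (-(2 : ℝ)) j = ((L : ℝ) ^ j * η) ^ 2 := by
    have := B8ScaledSupNorm.weight_neg_natCast L η 2 j
    simpa using this
  rw [e] at h
  exact h

end KLevel

/-! ## §4 The Hermitian case (`A` self-adjoint in a C⋆-algebra) and the sentence shape -/

section Hermitian

variable {𝔸 : Type*} [CStarAlgebra 𝔸] [Nontrivial 𝔸]

open B8Eq155JBound (expCfg_iEta_mem_U1 norm_expCfg_iEta_sub_one_le)

omit [Nontrivial 𝔸] in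
/-- The `U₁`-bookkeeping for Hermitian `A` from (1.41) on the same bonds: `|e^{iηA(b)} − 1| ≤ η|A(b)| ≤ α₂(Lʲη)⁻¹η`
on `SideTouches S` ((24) of [3]). [cite: Balaban1985RegularSpaces, (1.41) p.83; Balaban1985Averaging, (24) p.21] -/
theorem norm_expCfg_sub_one_of_141 {η : ℝ} (hη : 0 ≤ η) {A : Site d → Fin d → 𝔸}
    (hAh : ∀ y κ, IsSelfAdjoint (A y κ)) {L j : ℕ} {α₂ : ℝ} {S : Set (Site d)}
    (h41 : ∀ y τ, SideTouches S y τ → ‖A y τ‖ ≤ α₂ * ((L : ℝ) ^ j * η)⁻¹) (y : Site d) (τ : Fin d)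
    (hy : SideTouches S y τ) : ‖(expCfg (iEta η A) y τ : 𝔸) - 1‖ ≤ α₂ * ((L : ℝ) ^ j * η)⁻¹ * η :=
  (norm_expCfg_iEta_sub_one_le hη hAh y τ).trans
    ((mul_le_mul_of_nonneg_left (h41 y τ hy) hη).trans_eq (mul_comm _ _))

/-- **(1.55), NORM FORM AT `k` LEVELS, FOR HERMITIAN `A`** (`U₁ = e^{iηA}` unitary and `|U₁ − 1| ≤ η|A|`
discharged): from (1.40) `U₀, U₁U₀ ∈ 𝔄_k({Ω_j}, α₀)`, (1.41) on `SideTouches (Ω j)` (`j ≤ k`), a gradient datum `g` and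
`16α₂ ≤ 1`, `5α₂(d − 1) ≤ 4`: `|J|_(−3) ≤ 2α₀ + 36dα₂·g + 50dα₂³ + 10dα₀α₂`.
[cite: Balaban1985RegularSpaces, (1.55) p.86 (second form)] -/
theorem eq155_norm_kLevel_hermitian {η : ℝ} (hη : 0 < η) {L : ℕ} (hL : 1 ≤ L) {k : ℕ}
    {U₀ : Site d → Fin d → 𝔸ˣ} (h₀ : ∀ y κ, U₀ y κ ∈ U1 𝔸) {A : Site d → Fin d → 𝔸}
    (hAh : ∀ y κ, IsSelfAdjoint (A y κ)) {α₀ α₂ g : ℝ} (hα₀ : 0 ≤ α₀) (hα₂ : 0 ≤ α₂) (h16 : 16 * α₂ ≤ 1)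
    (hd5 : 5 * α₂ * ((d : ℝ) - 1) ≤ 4) (hg0 : 0 ≤ g) {Ω : ℕ → Set (Site d)} (h40₀ : InAk L k η α₀ Ω U₀)
    (h40₁ : InAk L k η α₀ Ω (mulCfg (expCfg (iEta η A)) U₀))
    (h41 : ∀ j, j ≤ k → ∀ y τ, SideTouches (Ω j) y τ → ‖A y τ‖ ≤ α₂ * ((L : ℝ) ^ j * η)⁻¹)
    (hg : ∀ j, j ≤ k → ∀ (y : Site d) (κ τ : Fin d), SideTouches (Ω j) y τ →
      ((L : ℝ) ^ j * η) ^ 2 * ‖covDerivFwd η U₀ κ (fun z => A z τ) y‖ ≤ g) :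
    bondNorm L k η (-(3 : ℝ)) Ω (fun x μ => Jcur η U₀ A μ x) ≤
      2 * α₀ + 36 * d * α₂ * g + 50 * d * α₂ ^ 3 + 10 * d * α₀ * α₂ :=
  eq155_norm_kLevel hη hL h₀ (expCfg_iEta_mem_U1 η hAh) hα₀ hα₂ h16 hd5 hg0 h40₀ h40₁ h41
    (fun j _ y τ hy => norm_expCfg_sub_one_of_141 hη.le hAh (h41 j ‹_›) y τ hy) hg

/-- **(1.55) «on Ω_j», k-LEVEL NORM FORM, IN SENTENCE SHAPE** («for α₀, α₂ … small», cf. p. 83 «We expect that we have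
to assume that α₀ + α₁ is sufficiently small»): there is `c > 0` (`c = 1/(16d)`, `d ≥ 1`) such that for all
`α₀ ≥ 0`, `0 ≤ α₂ ≤ c`, every `η > 0`, `L ≥ 1`, `k`, every family `{Ω_j}`, every `U1`-valued `U₀`, every Hermitian
`A` with (1.40) `U₀, e^{iηA}U₀ ∈ 𝔄_k({Ω_j}, α₀)` and (1.41) on `SideTouches (Ω j)` (`j ≤ k`), and every gradient datum
`g ≥ 0` as in `eq155_norm_kLevel`: `|J|_(−3) ≤ 2α₀ + 36dα₂·g + 50dα₂³ + 10dα₀α₂`.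
[cite: Balaban1985RegularSpaces, (1.55) p.86 (second form)] -/
theorem eq155_kLevel (hd1 : 1 ≤ d) :
    ∃ c : ℝ, 0 < c ∧ ∀ α₀ α₂ : ℝ, 0 ≤ α₀ → 0 ≤ α₂ → α₂ ≤ c →
      ∀ (η : ℝ), 0 < η → ∀ (L : ℕ), 1 ≤ L → ∀ (k : ℕ) (Ω : ℕ → Set (Site d))
        (U₀ : Site d → Fin d → 𝔸ˣ), (∀ y κ, U₀ y κ ∈ U1 𝔸) →
        ∀ A : Site d → Fin d → 𝔸, (∀ y κ, IsSelfAdjoint (A y κ)) →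
          InAk L k η α₀ Ω U₀ → InAk L k η α₀ Ω (mulCfg (expCfg (iEta η A)) U₀) →
          (∀ j, j ≤ k → ∀ y τ, SideTouches (Ω j) y τ → ‖A y τ‖ ≤ α₂ * ((L : ℝ) ^ j * η)⁻¹) →
          ∀ g : ℝ, 0 ≤ g →
            (∀ j, j ≤ k → ∀ (y : Site d) (κ τ : Fin d), SideTouches (Ω j) y τ →
              ((L : ℝ) ^ j * η) ^ 2 * ‖covDerivFwd η U₀ κ (fun z => A z τ) y‖ ≤ g) →
            bondNorm L k η (-(3 : ℝ)) Ω (fun x μ => Jcur η U₀ A μ x) ≤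
              2 * α₀ + 36 * d * α₂ * g + 50 * d * α₂ ^ 3 + 10 * d * α₀ * α₂ := by
  have hd1' : (1 : ℝ) ≤ d := by exact_mod_cast hd1
  refine ⟨1 / (16 * d), by positivity, ?_⟩
  intro α₀ α₂ hα₀ hα₂ hα₂c η hη L hL k Ω U₀ h₀ A hAh h40₀ h40₁ h41 g hg0 hg
  have h16d : (0 : ℝ) < 16 * d := by positivity
  have h16 : 16 * α₂ ≤ 1 := by
    have h1 : α₂ ≤ 1 / 16 := hα₂c.trans (one_div_le_one_div_of_le (by norm_num) (by linarith))
    linarith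
  have hdα₂ : (d : ℝ) * α₂ ≤ 1 / 16 := by
    have := hα₂c; rw [le_div_iff₀ h16d] at this; nlinarith
  have hd5 : 5 * α₂ * ((d : ℝ) - 1) ≤ 4 := by nlinarith
  exact eq155_norm_kLevel_hermitian hη hL h₀ hAh hα₀ hα₂ h16 hd5 hg0 h40₀ h40₁ h41 hg

end Hermitian

/-! ## §5 The feed into the bootstrap (1.59) ⇒ (1.60) at `k` levels (`B8.apriori_160`) -/

section Bootstrap

variable {𝔸 : Type*} [CStarAlgebra 𝔸] [Nontrivial 𝔸]

/-- **(1.55) ⇒ (1.59) ⇒ (1.60) AT `k` LEVELS, FOR HERMITIAN `A`.**  With `nJ := |J|_(−3)` the k-level norm of §3 (so that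
the input `h55` of `B8.apriori_160` is the THEOREM `eq155_norm_kLevel_hermitian`), the gradient datum `g` (standing for
`|∇^η_{U₀}A|_(−2)`), (1.56) `|B₁| ≤ 2dLα₁ + C₂α₂²` and the four bounds (1.59) `|A|_(−1), |∇^η_{U₀}A|_(−2),
|D^{η*}D^ηA|_(−3), |Δ^ηA|_(−3) ≦ B₀(|J|_(−3) + |B₁|)` (Theorem 3.3 of [4]) as real hypotheses in the same k-level
currency, «B₀36dα₂ ≦ 1/2» and `50dα₂ ≤ 1`: the four bounds (1.60)
`… ≤ B₀(4α₀ + 4dLα₁ + 2α₂² + 20dα₀α₂ + 2C₂α₂²)`. [cite: Balaban1985RegularSpaces, (1.55)-(1.60) p.86] -/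
theorem apriori_160_kLevel {η : ℝ} (hη : 0 < η) {L : ℕ} (hL : 1 ≤ L) {k : ℕ}
    {U₀ : Site d → Fin d → 𝔸ˣ} (h₀ : ∀ y κ, U₀ y κ ∈ U1 𝔸) {A : Site d → Fin d → 𝔸}
    (hAh : ∀ y κ, IsSelfAdjoint (A y κ)) {α₀ α₂ g : ℝ} (hα₀ : 0 ≤ α₀) (hα₂ : 0 ≤ α₂) (h16 : 16 * α₂ ≤ 1)
    (hd5 : 5 * α₂ * ((d : ℝ) - 1) ≤ 4) (hg0 : 0 ≤ g) {Ω : ℕ → Set (Site d)} (h40₀ : InAk L k η α₀ Ω U₀)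
    (h40₁ : InAk L k η α₀ Ω (mulCfg (expCfg (iEta η A)) U₀))
    (h41 : ∀ j, j ≤ k → ∀ y τ, SideTouches (Ω j) y τ → ‖A y τ‖ ≤ α₂ * ((L : ℝ) ^ j * η)⁻¹)
    (hg : ∀ j, j ≤ k → ∀ (y : Site d) (κ τ : Fin d), SideTouches (Ω j) y τ →
      ((L : ℝ) ^ j * η) ^ 2 * ‖covDerivFwd η U₀ κ (fun z => A z τ) y‖ ≤ g)
    {C₂ B₀ α₁ nB a j₂ l : ℝ} (hB₀ : 0 ≤ B₀) (h56 : nB ≤ 2 * d * L * α₁ + C₂ * α₂ ^ 2)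
    (h59a : a ≤ B₀ * (bondNorm L k η (-(3 : ℝ)) Ω (fun x μ => Jcur η U₀ A μ x) + nB))
    (h59g : g ≤ B₀ * (bondNorm L k η (-(3 : ℝ)) Ω (fun x μ => Jcur η U₀ A μ x) + nB))
    (h59j : j₂ ≤ B₀ * (bondNorm L k η (-(3 : ℝ)) Ω (fun x μ => Jcur η U₀ A μ x) + nB))
    (h59l : l ≤ B₀ * (bondNorm L k η (-(3 : ℝ)) Ω (fun x μ => Jcur η U₀ A μ x) + nB))
    (hside : 36 * d * B₀ * α₂ ≤ 1 / 2) (h50 : 50 * d * α₂ ≤ 1) :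
    a ≤ B₀ * (4 * α₀ + 4 * d * L * α₁ + 2 * α₂ ^ 2 + 20 * d * α₀ * α₂ + 2 * C₂ * α₂ ^ 2) ∧
    g ≤ B₀ * (4 * α₀ + 4 * d * L * α₁ + 2 * α₂ ^ 2 + 20 * d * α₀ * α₂ + 2 * C₂ * α₂ ^ 2) ∧
    j₂ ≤ B₀ * (4 * α₀ + 4 * d * L * α₁ + 2 * α₂ ^ 2 + 20 * d * α₀ * α₂ + 2 * C₂ * α₂ ^ 2) ∧
    l ≤ B₀ * (4 * α₀ + 4 * d * L * α₁ + 2 * α₂ ^ 2 + 20 * d * α₀ * α₂ + 2 * C₂ * α₂ ^ 2) :=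
  B8.apriori_160 (Nat.cast_nonneg d) hB₀ hα₂ hg0
    (eq155_norm_kLevel_hermitian hη hL h₀ hAh hα₀ hα₂ h16 hd5 hg0 h40₀ h40₁ h41 hg) h56 h59a h59g h59j h59l
    hside h50

end Bootstrap

#print axioms eq155_printed_loc
#print axioms eq155_scaled_condAt
#print axioms eq155_norm_kLevel
#print axioms eq155_norm_kLevel_msup
#print axioms eq155_kLevel
#print axioms apriori_160_kLevel

end Literature.MathematicalPhysics.QuantumFieldTheory.Balaban1983to89.B8Eq155KLevelLocal

end
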